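import Mathlib
import Literature.Analysis.FluidPDE.CompressibleEulerImplosionOriginSeries

/-!
# The sub-Catalan majorant lemma for the hierarchy of the analytic packing implosion `Γ`
# (crux `DenseExcursion`, stmt-AtomisticToContinuum-12586, line `packing-analytic-implosion`)

Helper file (`--supports stmt-AtomisticToContinuum-12586`, line lead a2, stub `stub_analyticPackingImplosion` of
`Summits/AtomisticToContinuum/HydrodynamicLimit/Theorems/ImplosionDichotomyDenseExcursionPackingAnalyticDefs.lean`):
the CONVERGENCE half of the majorant argument for the packing series
`Γ(G, x) = SS(x) + Σ_{k ≥ 1} Gᵏ X_k(x)` of `AnalyticPackingImplosion`. If the order-`k` norms `t k = ‖X_k‖` obey a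
SUB-CATALAN recursion `t k ≤ C · Σ_{i=1}^{k-1} t i · t (k − i)` for `k ≥ 2` — the shape produced by a quadratic
nonlinearity together with a resolvent bound `‖(kμ − L)⁻¹‖ ≤ C` uniform in the order `k` — then the sequence grows at
most geometrically and the packing series converges on a disc:

* `subcatalan_le_catalan` (sharp): `t k ≤ C^{k−1} (t 1)^k 𝔠_{k−1}` (`𝔠 = catalan`), by strong induction and Catalan's
  convolution identity `Σ_{i=1}^{k−1} 𝔠_{i−1} 𝔠_{k−1−i} = 𝔠_{k−1}` (`catalan_conv_Ico`) — equality for the extremal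
  sequence `t k = C Σ t i t (k−i)`;
* `subcatalan_geometric`: `t k ≤ t 1 · (4 C t 1)^{k−1}` (from `𝔠ₙ ≤ 4ⁿ`, the tree's
  `Literature.Analysis.FluidPDE.BuckmasterCaolaboraGomezserrano2025.OriginSeries.catalan_le_four_pow`);
* `subcatalan_majorant` (REGISTERED helper name, the planner's closed form):
  `t k ≤ t 1 · (4 · max(C,1) · max(t 1, 1))^{k−1}` for `k ≥ 1`;
* `summable_of_subcatalan_abs` (sharp radius `1/(4 C t 1)`, two-sided in `g`) and `summable_of_subcatalan`
  (REGISTERED, the planner's form `0 ≤ g < 1/(4 max(C,1) max(t 1,1))`): `Summable (fun k => t k * g ^ k)`.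

Pure real analysis over Mathlib (`catalan`, `catalan_succ'`, `summable_geometric_of_lt_one`,
`Summable.of_norm_bounded`) and the tree's `catalan_le_four_pow` (`CompressibleEulerImplosionOriginSeries.lean`); same
pattern as `Literature/Analysis/FluidPDE/CompressibleEulerImplosionSonicAnalytic.lean` (`catalan_majorant`,
`geom_of_catalan`, there for the BCG sonic-point Taylor recursion). NOT here: the norms in which the hierarchy of `Γ`
closes, the resolvent estimates producing the recursion, or any statement about the profile — see the stub's report.
-/

noncomputable section

open Finset
open Literature.Analysis.FluidPDE.BuckmasterCaolaboraGomezserrano2025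

namespace Summit.AtomisticToContinuum.HydrodynamicLimit.Theorems.PackingAnalyticImplosion

/-! ## Catalan bookkeeping -/

/-- Catalan's convolution identity over `ℝ`, indexed by `Finset.Ico 1 (n + 2)` exactly as in the sub-Catalan
recursion: `Σ_{i=1}^{n+1} 𝔠_{i−1} 𝔠_{n+1−i} = 𝔠_{n+1}`. [folklore] -/
theorem catalan_conv_Ico (n : ℕ) :
    ∑ i ∈ Ico 1 (n + 2), (catalan (i - 1) : ℝ) * catalan (n + 1 - i) = catalan (n + 1) := by
  have h : ∑ i ∈ Ico 1 (n + 2), catalan (i - 1) * catalan (n + 1 - i) = catalan (n + 1) := by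
    rw [sum_Ico_eq_sum_range, catalan_succ',
      Nat.sum_antidiagonal_eq_sum_range_succ (fun i j => catalan i * catalan j),
      show n + 2 - 1 = n + 1 by omega]
    refine sum_congr rfl fun k _ => ?_
    rw [show 1 + k - 1 = k by omega, show n + 1 - (1 + k) = n - k by omega]
  exact_mod_cast h

/-! ## The sub-Catalan majorant -/

/-- **Sharp sub-Catalan majorant.** A nonnegative sequence with `t k ≤ C Σ_{i=1}^{k−1} t i · t (k − i)` for all
`k ≥ 2` (`C ≥ 0`) satisfies `t k ≤ C^{k−1} (t 1)^k 𝔠_{k−1}` for all `k ≥ 1`: the extremal sequence (equality in the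
recursion) has generating function `T(z) = t₁ z + C T(z)²`, i.e. `T = (1 − √(1 − 4 C t₁ z))/(2C)`. [folklore] -/
theorem subcatalan_le_catalan {t : ℕ → ℝ} {C : ℝ} (hC : 0 ≤ C) (ht : ∀ k, 0 ≤ t k)
    (hrec : ∀ k, 2 ≤ k → t k ≤ C * ∑ i ∈ Finset.Ico 1 k, t i * t (k - i)) :
    ∀ k, 1 ≤ k → t k ≤ C ^ (k - 1) * t 1 ^ k * catalan (k - 1) := by
  intro k
  induction k using Nat.strong_induction_on with
  | _ k ih =>
  intro hk
  have ht1 : 0 ≤ t 1 := ht 1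
  rcases Nat.lt_or_ge k 2 with hk1 | hk2
  · obtain rfl : k = 1 := by omega
    simp
  · obtain ⟨n, rfl⟩ : ∃ n, k = n + 2 := ⟨k - 2, by omega⟩
    -- the induction hypothesis on both factors of each term of the convolution
    have hb : ∀ i ∈ Ico 1 (n + 2), t i * t (n + 2 - i) ≤
        (C ^ (i - 1) * t 1 ^ i * catalan (i - 1)) *
          (C ^ (n + 1 - i) * t 1 ^ (n + 2 - i) * catalan (n + 1 - i)) := by
      intro i hi
      rw [mem_Ico] at hi
      have h1 := ih i (by omega) (by omega)
      have h2 := ih (n + 2 - i) (by omega) (by omega)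
      rw [show n + 2 - i - 1 = n + 1 - i by omega] at h2
      exact mul_le_mul h1 h2 (ht _) (by positivity)
    calc t (n + 2) ≤ C * ∑ i ∈ Ico 1 (n + 2), t i * t (n + 2 - i) := hrec _ (by omega)
      _ ≤ C * ∑ i ∈ Ico 1 (n + 2), (C ^ (i - 1) * t 1 ^ i * catalan (i - 1)) *
            (C ^ (n + 1 - i) * t 1 ^ (n + 2 - i) * catalan (n + 1 - i)) :=
          mul_le_mul_of_nonneg_left (sum_le_sum hb) hC
      _ = C * (C ^ n * t 1 ^ (n + 2) *
            ∑ i ∈ Ico 1 (n + 2), ((catalan (i - 1) : ℝ) * catalan (n + 1 - i))) := by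
          congr 1
          rw [Finset.mul_sum]
          refine sum_congr rfl fun i hi => ?_
          rw [mem_Ico] at hi
          have e1 : C ^ (i - 1) * C ^ (n + 1 - i) = C ^ n := by
            rw [← pow_add]; congr 1; omega
          have e2 : t 1 ^ i * t 1 ^ (n + 2 - i) = t 1 ^ (n + 2) := by
            rw [← pow_add]; congr 1; omega
          calc C ^ (i - 1) * t 1 ^ i * catalan (i - 1) *
                (C ^ (n + 1 - i) * t 1 ^ (n + 2 - i) * catalan (n + 1 - i))
              = (C ^ (i - 1) * C ^ (n + 1 - i)) * (t 1 ^ i * t 1 ^ (n + 2 - i)) *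
                  ((catalan (i - 1) : ℝ) * catalan (n + 1 - i)) := by ring
            _ = C ^ n * t 1 ^ (n + 2) * ((catalan (i - 1) : ℝ) * catalan (n + 1 - i)) := by rw [e1, e2]
      _ = C ^ (n + 2 - 1) * t 1 ^ (n + 2) * catalan (n + 2 - 1) := by
          rw [catalan_conv_Ico, show n + 2 - 1 = n + 1 by omega, pow_succ]
          ring

/-- **Geometric growth from a sub-Catalan recursion**, sharp rate: `t k ≤ t 1 · (4 C t 1)^{k−1}` for `k ≥ 1`.
[folklore] -/
theorem subcatalan_geometric {t : ℕ → ℝ} {C : ℝ} (hC : 0 ≤ C) (ht : ∀ k, 0 ≤ t k)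
    (hrec : ∀ k, 2 ≤ k → t k ≤ C * ∑ i ∈ Finset.Ico 1 k, t i * t (k - i)) :
    ∀ k, 1 ≤ k → t k ≤ t 1 * (4 * C * t 1) ^ (k - 1) := by
  intro k hk
  have ht1 : 0 ≤ t 1 := ht 1
  calc t k ≤ C ^ (k - 1) * t 1 ^ k * catalan (k - 1) := subcatalan_le_catalan hC ht hrec k hk
    _ ≤ C ^ (k - 1) * t 1 ^ k * 4 ^ (k - 1) := by
        gcongr
        exact OriginSeries.catalan_le_four_pow _
    _ = t 1 * (4 * C * t 1) ^ (k - 1) := by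
        obtain ⟨m, rfl⟩ : ∃ m, k = m + 1 := ⟨k - 1, by omega⟩
        simp only [Nat.add_sub_cancel, mul_pow, pow_succ]
        ring

/-- **THE SUB-CATALAN MAJORANT LEMMA** (registered helper `subcatalan_majorant` of `stub_analyticPackingImplosion`,
the planner's closed form): a nonnegative sequence with `t k ≤ C Σ_{i=1}^{k−1} t i · t (k − i)` (`k ≥ 2`, `C ≥ 0`)
grows at most geometrically, `t k ≤ t 1 · (4 · max(C,1) · max(t 1, 1))^{k−1}` for `k ≥ 1`. A sub-Catalan recursion
forces GEOMETRIC growth, hence `Σ t k Gᵏ` converges for small `|G|` (`summable_of_subcatalan`). [folklore] -/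
theorem subcatalan_majorant :
    ∀ (t : ℕ → ℝ) (C : ℝ), 0 ≤ C → (∀ k, 0 ≤ t k) → (∀ k, 2 ≤ k → t k ≤ C * ∑ i ∈ Finset.Ico 1 k, t i * t (k - i)) → ∀ k, 1 ≤ k → t k ≤ t 1 * (4 * max C 1 * max (t 1) 1) ^ (k - 1) := by
  intro t C hC ht hrec k hk
  have ht1 : 0 ≤ t 1 := ht 1
  calc t k ≤ t 1 * (4 * C * t 1) ^ (k - 1) := subcatalan_geometric hC ht hrec k hk
    _ ≤ t 1 * (4 * max C 1 * max (t 1) 1) ^ (k - 1) := by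
        gcongr
        · exact le_max_left _ _
        · exact le_max_left _ _

/-! ## Convergence of the packing series -/

/-- **Convergence from a sub-Catalan recursion, sharp radius** (two-sided in the packing parameter): under the
hypotheses of `subcatalan_majorant`, `Σ_k t k · gᵏ` converges whenever `|g| · 4 C t 1 < 1` (every `g` if
`C t 1 = 0`). [folklore] -/
theorem summable_of_subcatalan_abs {t : ℕ → ℝ} {C : ℝ} (hC : 0 ≤ C) (ht : ∀ k, 0 ≤ t k)
    (hrec : ∀ k, 2 ≤ k → t k ≤ C * ∑ i ∈ Finset.Ico 1 k, t i * t (k - i)) {g : ℝ}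
    (hg : |g| * (4 * C * t 1) < 1) : Summable (fun k => t k * g ^ k) := by
  have ht1 : 0 ≤ t 1 := ht 1
  set ρ : ℝ := 4 * C * t 1 with hρ
  have hρ0 : 0 ≤ ρ := by positivity
  have hq0 : 0 ≤ |g| * ρ := by positivity
  -- drop the order-zero term and compare with the geometric series `t 1 |g| (|g| ρ)^k`
  rw [← summable_nat_add_iff 1]
  refine Summable.of_norm_bounded (g := fun k : ℕ => t 1 * |g| * (|g| * ρ) ^ k)
    ((summable_geometric_of_lt_one hq0 hg).mul_left _) fun k => ?_
  rw [Real.norm_eq_abs, abs_mul, abs_of_nonneg (ht _), abs_pow]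
  calc t (k + 1) * |g| ^ (k + 1) ≤ t 1 * ρ ^ k * |g| ^ (k + 1) := by
        gcongr
        simpa using subcatalan_geometric hC ht hrec (k + 1) (by omega)
    _ = t 1 * |g| * (|g| * ρ) ^ k := by ring

/-- **CONVERGENCE OF THE PACKING SERIES** (registered helper `summable_of_subcatalan` of
`stub_analyticPackingImplosion`, the planner's form): under the hypotheses of `subcatalan_majorant`,
`Σ_k t k · gᵏ` converges for `0 ≤ g < 1/(4 · max(C,1) · max(t 1,1))`. [folklore] -/
theorem summable_of_subcatalan :
    ∀ (t : ℕ → ℝ) (C : ℝ), 0 ≤ C → (∀ k, 0 ≤ t k) → (∀ k, 2 ≤ k → t k ≤ C * ∑ i ∈ Finset.Ico 1 k, t i * t (k - i)) → ∀ g : ℝ, 0 ≤ g → g < 1 / (4 * max C 1 * max (t 1) 1) → Summable (fun k => t k * g ^ k) := by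
  intro t C hC ht hrec g hg0 hg
  have ht1 : 0 ≤ t 1 := ht 1
  refine summable_of_subcatalan_abs hC ht hrec ?_
  have hM : 0 < 4 * max C 1 * max (t 1) 1 := by positivity
  rw [lt_div_iff₀ hM] at hg
  rw [abs_of_nonneg hg0]
  calc g * (4 * C * t 1) ≤ g * (4 * max C 1 * max (t 1) 1) := by
        gcongr
        · exact le_max_left _ _
        · exact le_max_left _ _
    _ < 1 := hg

end Summit.AtomisticToContinuum.HydrodynamicLimit.Theorems.PackingAnalyticImplosion

end
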